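import Literature.NumberTheory.GaloisRepresentations.ArtinRestriction
import HarnessLib

/-!
# Reducible two-dimensional representations have solvable image (helper for item
# stmt-Langlands-13459 `ResidualBianchiDoorMod2`, route ParityBlindBianchi)

Over ANY field `k`: if the standard representation of `ρ : G → GL₂(k)` on `k²` is reducible then
`ρ(G)` is solvable — a proper non-trivial subrepresentation is a line, i.e. a common eigenvector
(`hasCommonEigenvector_of_not_isIrreducible`, the argument of the tree's characteristic-`0`
`isIrreducible_of_not_isCyclicType`), conjugating it to `e₀` puts `ρ(G)` inside the Borel subgroup of
upper triangular matrices (`exists_mulVec_single_eq`), and a group of upper triangular matrices is an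
extension of a subgroup of `kˣ × kˣ` (diagonal entries) by an abelian group of unipotent matrices
(`isSolvable_of_forall_apply_eq_zero`).  Main statement: `isSolvable_range_of_not_isIrreducible`.
Used (in characteristic `ℓ`, where the tree's characteristic-`0` irreducibility criteria do not
apply) to prove that the mod-`ℓ` reduction of an icosahedral Artin representation is irreducible.

Reference: J.-P. Serre, *Linear representations of finite groups*, §8.5 (supersolvable/Borel);
standard. [folklore]
-/

noncomputable section

set_option linter.dupNamespace false -- `Summit.Langlands.Langlands` is the mandated namespace (D-0017)

open scoped MatrixGroups Matrix
open Literature.NumberTheory.GaloisRepresentations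

namespace Summit.Langlands.Langlands.Theorems.ResidualBianchiDoorMod2

/-! ### Reducible two-dimensional representations have solvable image -/

section Borel

variable {k : Type*} [Field k] {G : Type*} [Group G]

/-- Entries of a product of two upper triangular `2 × 2` matrices. [folklore] -/
theorem mul_apply_of_upper {a b : Matrix (Fin 2) (Fin 2) k} (ha : a 1 0 = 0) (hb : b 1 0 = 0) :
    (a * b) 0 0 = a 0 0 * b 0 0 ∧ (a * b) 1 1 = a 1 1 * b 1 1 ∧ (a * b) 1 0 = 0 ∧
      (a * b) 0 1 = a 0 0 * b 0 1 + a 0 1 * b 1 1 := by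
  simp only [Matrix.mul_apply, Fin.sum_univ_two, ha, hb, mul_zero, zero_mul, add_zero, zero_add,
    and_self]

/-- **A subgroup of upper triangular matrices in `GL₂(k)` is solvable**: the diagonal entries give a
homomorphism to the abelian group `kˣ × kˣ` whose kernel (unipotent matrices) is abelian.
[folklore] -/
theorem isSolvable_of_forall_apply_eq_zero (H : Subgroup (GL (Fin 2) k))
    (hH : ∀ g ∈ H, ((g : GL (Fin 2) k) : Matrix (Fin 2) (Fin 2) k) 1 0 = 0) : IsSolvable H := by
  have hne : ∀ g ∈ H, ((g : GL (Fin 2) k) : Matrix (Fin 2) (Fin 2) k) 0 0 ≠ 0 ∧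
      ((g : GL (Fin 2) k) : Matrix (Fin 2) (Fin 2) k) 1 1 ≠ 0 := by
    intro g hg
    have hdet : ((g : GL (Fin 2) k) : Matrix (Fin 2) (Fin 2) k).det ≠ 0 := by
      rw [← Matrix.GeneralLinearGroup.val_det_apply]
      exact (Matrix.GeneralLinearGroup.det g).ne_zero
    rw [Matrix.det_fin_two, hH g hg, mul_zero, sub_zero] at hdet
    exact ⟨left_ne_zero_of_mul hdet, right_ne_zero_of_mul hdet⟩
  let f : H →* kˣ × kˣ :=
    { toFun := fun g => (Units.mk0 _ (hne g g.2).1, Units.mk0 _ (hne g g.2).2)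
      map_one' := by
        ext <;> simp
      map_mul' := fun g h => by
        obtain ⟨h00, h11, -, -⟩ := mul_apply_of_upper (hH g g.2) (hH h h.2)
        ext
        · simp only [Subgroup.coe_mul, Units.val_mul, Units.val_mk0, Prod.fst_mul]
          exact h00
        · simp only [Subgroup.coe_mul, Units.val_mul, Units.val_mk0, Prod.snd_mul]
          exact h11 }
  have hf : ∀ g : H, g ∈ f.ker ↔ ((g : GL (Fin 2) k) : Matrix (Fin 2) (Fin 2) k) 0 0 = 1 ∧
      ((g : GL (Fin 2) k) : Matrix (Fin 2) (Fin 2) k) 1 1 = 1 := by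
    intro g
    rw [MonoidHom.mem_ker, Prod.ext_iff]
    simp only [f, MonoidHom.coe_mk, OneHom.coe_mk, Prod.fst_one, Prod.snd_one, Units.ext_iff,
      Units.val_mk0, Units.val_one]
  haveI : IsSolvable f.ker := by
    refine isSolvable_of_comm fun a b => ?_
    obtain ⟨ha0, ha1⟩ := (hf a).mp a.2
    obtain ⟨hb0, hb1⟩ := (hf b).mp b.2
    have ha := hH _ a.1.2
    have hb := hH _ b.1.2
    apply Subtype.ext; apply Subtype.ext; apply Units.ext
    change ((a : H) : GL (Fin 2) k).1 * ((b : H) : GL (Fin 2) k).1 =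
      ((b : H) : GL (Fin 2) k).1 * ((a : H) : GL (Fin 2) k).1
    obtain ⟨p00, p11, p10, p01⟩ := mul_apply_of_upper ha hb
    obtain ⟨q00, q11, q10, q01⟩ := mul_apply_of_upper hb ha
    ext i j
    fin_cases i <;> fin_cases j
    · simp only [Fin.zero_eta, Fin.isValue]; rw [p00, q00, mul_comm]
    · simp only [Fin.zero_eta, Fin.isValue, Fin.mk_one]
      rw [p01, q01, ha0, ha1, hb0, hb1]; ring
    · simp only [Fin.mk_one, Fin.isValue, Fin.zero_eta]; rw [p10, q10]
    · simp only [Fin.mk_one, Fin.isValue]; rw [p11, q11, mul_comm]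
  exact solvable_of_ker_le_range f.ker.subtype f (by rw [Subgroup.range_subtype])

/-- A reducible two-dimensional representation (over any field) has a common eigenvector: a proper
non-trivial subrepresentation of `k²` is a line. [folklore] -/
theorem hasCommonEigenvector_of_not_isIrreducible (ρ : G →* GL (Fin 2) k)
    (h : ¬ (toStdRepresentation ρ).IsIrreducible) : HasCommonEigenvector ρ := by
  classical
  haveI : Nontrivial (Subrepresentation (toStdRepresentation ρ)) := by
    refine ⟨⟨⊥, ⊤, fun hbt => ?_⟩⟩
    have : (Pi.single 0 1 : Fin 2 → k) ∈ (⊥ : Subrepresentation (toStdRepresentation ρ)) := by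
      rw [hbt]; trivial
    have h0 : (Pi.single 0 1 : Fin 2 → k) = 0 := this
    exact one_ne_zero (congrFun h0 0)
  by_contra hno
  apply h
  refine ⟨fun W => ?_⟩
  by_contra! hW
  obtain ⟨hWb, hWt⟩ := hW
  apply hno
  have hcoe : (W : Set (Fin 2 → k)) = (W.toSubmodule : Set (Fin 2 → k)) := rfl
  have hne : W.toSubmodule ≠ ⊤ := fun htop => by
    apply hWt
    apply SetLike.coe_injective
    rw [hcoe, htop]
    rfl
  have hlt : Module.finrank k W.toSubmodule < 2 := by
    have h2 := Submodule.finrank_lt hne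
    rwa [Module.finrank_fin_fun] at h2
  have hpos : 0 < Module.finrank k W.toSubmodule := by
    rw [Module.finrank_pos_iff_exists_ne_zero]
    by_contra! hz
    apply hWb
    apply SetLike.coe_injective
    rw [hcoe]
    have hb : W.toSubmodule = ⊥ := by
      rw [Submodule.eq_bot_iff]
      intro x hx
      exact congrArg Subtype.val (hz ⟨x, hx⟩)
    rw [hb]
    rfl
  have h1 : Module.finrank k W.toSubmodule = 1 := by omega
  obtain ⟨w, hw⟩ := finrank_eq_one_iff'.mp h1
  refine ⟨(w : Fin 2 → k), fun h0 => hw.1 (Subtype.ext h0), fun g => ?_⟩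
  have hmem :
      ((ρ g : GL (Fin 2) k) : Matrix (Fin 2) (Fin 2) k) *ᵥ (w : Fin 2 → k) ∈ W.toSubmodule :=
    W.apply_mem_toSubmodule g w.2
  obtain ⟨a, ha⟩ := hw.2 ⟨_, hmem⟩
  exact ⟨a, by simpa using congrArg Subtype.val ha.symm⟩

/-- A non-zero vector of `k²` is the first column of an invertible matrix. [folklore] -/
theorem exists_mulVec_single_eq {v : Fin 2 → k} (hv : v ≠ 0) :
    ∃ Q : GL (Fin 2) k, ((Q : GL (Fin 2) k) : Matrix (Fin 2) (Fin 2) k) *ᵥ Pi.single 0 1 = v := by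
  by_cases h0 : v 0 = 0
  · have h1 : v 1 ≠ 0 := by
      intro h1; apply hv; ext i; fin_cases i <;> simp [h0, h1]
    refine ⟨Matrix.GeneralLinearGroup.mkOfDetNeZero !![v 0, 1; v 1, 0] ?_, ?_⟩
    · rw [Matrix.det_fin_two_of]; simpa using h1
    · ext i
      fin_cases i <;> simp [Matrix.GeneralLinearGroup.mkOfDetNeZero]
  · refine ⟨Matrix.GeneralLinearGroup.mkOfDetNeZero !![v 0, 0; v 1, 1] ?_, ?_⟩
    · rw [Matrix.det_fin_two_of]; simpa using h0
    · ext i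
      fin_cases i <;> simp [Matrix.GeneralLinearGroup.mkOfDetNeZero]

/-- **A reducible `ρ : G → GL₂(k)` has solvable image** (any field `k`): conjugating a common
eigenvector to `e₀` puts the image in the Borel subgroup. [folklore] -/
theorem isSolvable_range_of_not_isIrreducible (ρ : G →* GL (Fin 2) k)
    (h : ¬ (toStdRepresentation ρ).IsIrreducible) : IsSolvable ρ.range := by
  obtain ⟨v, hv, hev⟩ := hasCommonEigenvector_of_not_isIrreducible ρ h
  obtain ⟨Q, hQ⟩ := exists_mulVec_single_eq hv
  -- the conjugate `Q⁻¹ ρ Q` is upper triangular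
  have hup : ∀ g, ((conjGL Q⁻¹ ρ g : GL (Fin 2) k) : Matrix (Fin 2) (Fin 2) k) 1 0 = 0 := by
    intro g
    obtain ⟨a, ha⟩ := hev g
    have hcol : ((conjGL Q⁻¹ ρ g : GL (Fin 2) k) : Matrix (Fin 2) (Fin 2) k) *ᵥ Pi.single 0 1 =
        a • Pi.single 0 1 := by
      rw [conjGL_apply, inv_inv, Matrix.GeneralLinearGroup.coe_mul, Matrix.GeneralLinearGroup.coe_mul,
        ← Matrix.mulVec_mulVec, ← Matrix.mulVec_mulVec, hQ, ha, Matrix.mulVec_smul, ← hQ,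
        Matrix.mulVec_mulVec, ← Matrix.GeneralLinearGroup.coe_mul, inv_mul_cancel,
        Matrix.GeneralLinearGroup.coe_one, Matrix.one_mulVec]
    have := congrFun hcol 1
    simpa [Matrix.mulVec_single_one] using this
  have hsol : IsSolvable (conjGL Q⁻¹ ρ).range :=
    isSolvable_of_forall_apply_eq_zero _ (by rintro _ ⟨g, rfl⟩; exact hup g)
  -- `ρ.range ≅ (Q⁻¹ ρ Q).range`
  have hrange : (conjGL Q⁻¹ ρ).range = ρ.range.map (MulAut.conj Q⁻¹).toMonoidHom :=
    MonoidHom.range_comp _ _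
  let e : ρ.range ≃* (conjGL Q⁻¹ ρ).range :=
    (ρ.range.equivMapOfInjective _ (MulAut.conj Q⁻¹).injective).trans
      (MulEquiv.subgroupCongr hrange.symm)
  exact solvable_of_solvable_injective (f := e.toMonoidHom) e.injective

end Borel

end Summit.Langlands.Langlands.Theorems.ResidualBianchiDoorMod2

end
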